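/- Copyright: the b2b-balaban cell (near-miss cell 7), T⁴-continuum fan-out, ROUND-2 swarm `t4-ne7b-formalise-*`
(leaf 09, gen 4), row NE7b (node U5c COUNT member).  Released under the licence of the surrounding project. -/
import Summits.QuantumFields.BalabanUV.T4Continuum.Support.HistoryRealiseCellsRunApex
import Literature.MathematicalPhysics.QuantumFieldTheory.Balaban1983to89.T4FiniteEpsInhabited

/-!
# Realised histories: the COUNT-ROAD WITNESS SHAPE IS INHABITED on a decided toy datum (node test (t5) of sub-row S12g, row S12h)

Summits-side support leaf of the T⁴-continuum cell (rung (B)+1 on a FINITE torus only; NOT infinite volume, NOT the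
mass gap, NOT the Clay statement; NOT a proof of the spine estimate NE7b).  Row S12h of the claim table
`t4/b2b-balaban-t4-ne7b-p1/LEAVES-NE7b.md` (referee ask C-t4r2-347, t4-ref2 pass 74): a NON-VACUITY NODE TEST of the
hypothesis shape `HistoryRealiseCellsRunApex.CountRoadWitness` (p219284) — the one displayed datum of the apex theorem
`hybridNE7Under_of_countRoad`.  A jointly unsatisfiable shape would make that theorem vacuously true; this file shows it
is not, and locates the ONE field that the tree's own inhabitant of the carrier cannot meet.

WHAT IS BUILT [decided toy; nothing of Bałaban's is modelled].
* §1 THE TOY DATUM `toyData F G : FiniteEpsData F G` — `T4FiniteEpsInhabited.stubData` (block averaging by the trivial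
  small-loop average, constant coupling flow, `numSites := 0`, Wilson weight `ρ₀`, Radon–Nikodym transports) with ONE
  field changed: the small-field characteristic function `χ := 1` instead of `0` (a sign convention, `signConventions_toy`;
  (B) still FAILS on it, `not_endStatementBPrinted_toy` — the toy certifies types, not theorems).  Consequence:
  `smallFieldMass (toyData F G) K g₀ = 1` (`smallFieldMass_toy`: `∫ 1 · e^{−0} dV = 1`, product Haar measure is a
  probability measure), whereas `smallFieldMass (stubData …) K g₀ = 0` (`smallFieldMass_stubData`).
* §2 THE TOY'S DRESSED INTEGRALS for the EMPTY loop string `os := []` (product observable `≡ 1`) at the tuned constant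
  run `g₀ ≡ 1` (`tuned_toy`): `Ztoy K t = ∫ e^{t·1} ρ₀ dU = e^t · Ztoy K 0 > 0` (`Ztoy_eq_exp_mul`, `Ztoy_pos`), so the
  two-run log-ratio `nuToy K = log (Ztoy (K+1) 0 ∕ Ztoy K 0)` is SOURCE-FREE: `e^{nuToy K}·Ztoy K t = Ztoy (K+1) t`.
* §3 THE WITNESS TERM **`toyWitness F G C O rr d n : CountRoadWitness (toyData F G) C O rr d n gOne [] Unit Empty Unit`**
  for EVERY `C O rr d n`: one term per cutoff (`T K := {()}`), `A K t () := Ztoy K t`, `A' K t () := Ztoy (K+1) t`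
  (`reprA`∕`reprB` by `sum_singleton`); NO live component (`α := Empty`, `liveC := ∅`) — every H3 field is VACUOUS
  (`memOf = ∅`: no bad term, no bad class — `not_mem_badTerms_toy`, `not_mem_badClasses_toy`); shells, dead weights,
  envelopes, class factors ZERO; `floor` with `c₀ := 1` by §1; `sites` with `n₁ := 0`; `isRj` with `R ≡ 1 = L^0`
  (`(log 1⁻²)^r = 0^r ≤ 1`); the NE7 core budget `ReindexedBudget` met EXACTLY: `Cc K t () := nuToy K`, `ν := nuToy`,
  `Rr = CcRec = RrRec = 0`, rates `u = s₂ = q₀ = r = s = 0`.  **`nonempty_countRoadWitness_toy`** (+ `exists_tuned_…`).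
* §4 THE LOCATED OBSTRUCTION ON THE TREE'S OWN INHABITANT: for `T4FiniteEpsInhabited.stubData` (χ := 0) the shape is
  EMPTY for every choice of the other parameters — **`isEmpty_countRoadWitness_stubData`** — because `floor` asks
  `0 < c₀ ≤ smallFieldMass = 0`: «satisfiable» on the χ := 1 twin, «satisfiable modulo ⟨floor⟩ only» on the placeholder.

HONEST.  A node test of a hypothesis SHAPE: it discharges NOTHING of the nine spine estimates; the empty string and the
absence of live components make the H3 ∕ NE7c ∕ NE7 fields trivial BY DESIGN (for a non-empty string on a non-trivial
group the source-uniformity of `ReindexedBudget` with summable rates is NE7's two-run comparison itself, available on no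
toy).  NE7b NOT proved; spine 0∕9.  HONEST DEPENDENCY (cell): continuum YM on T⁴ ⇐ BetaPertH ∧ nine spine estimates
(0/9 proved); BetaPertH ⇐ (D1) ∧ (D4) ∧ CAP+tail; G-an2-4 gates asym, D1 and NE2/3/4.  [folklore] decided toy on OUR
carriers; no `[cite:]`; no `def … : Prop`; nothing printed is asserted. -/

open Finset MeasureTheory
open Literature.MathematicalPhysics.QuantumFieldTheory.Balaban1983to89
open Literature.MathematicalPhysics.QuantumFieldTheory.Balaban1983to89.B13ScaleTransfer
open Literature.MathematicalPhysics.QuantumFieldTheory.Balaban1983to89.T4FiniteEpsInhabited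
open Missing AveragingRT T4Continuum T4StabilitySocket T4MatchingClosure T4IndicatorShell T4LiveClassFibration
open T4RenewalChains T4PersistenceDictionary T4BranchingRecordsGas
open Summit.QuantumFields.BalabanUV.T4Continuum.HistoryConstants
open Summit.QuantumFields.BalabanUV.T4Continuum.HistoryGen
open Summit.QuantumFields.BalabanUV.T4Continuum.HistoryAssemblyTerms
open Summit.QuantumFields.BalabanUV.T4Continuum.HistoryAssemblyPedigree
open Summit.QuantumFields.BalabanUV.T4Continuum.HistorySocketTH
open Summit.QuantumFields.BalabanUV.T4Continuum.HistoryAssemblyRealiseRun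
open Summit.QuantumFields.BalabanUV.T4Continuum.HistoryRealiseCellsRun
open Summit.QuantumFields.BalabanUV.T4Continuum.HistoryRealiseCellsRunApex

namespace Summit.QuantumFields.BalabanUV.T4Continuum.HistoryRealiseCellsRunApexWitness

noncomputable section

/-! ## §1 The toy datum: the placeholder inhabitant with `χ := 1` -/

section Toy

variable (F : T4Family) (G : Type) [GaugeGroup G] [MeasurableSpace G] [HaarData G]

/-- the toy's averagings: Bałaban's block averaging driven by the TRIVIAL small-loop average (= the axial averaging),
on every torus of the family [decided toy] -/
def toyAv : (K j : ℕ) → Averaging (F.P K) j G := fun _ _ => BlockAveraging.blockAvg (LoopAverage.trivial G)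

/-- the toy construction: `T4FiniteEpsInhabited.stubConstruction` for `toyAv` with the ONE change `χ := 1` (constant
coupling flow `g_k = g₀`, zero β-functions, `Cfg k` = gauge fields, `ρ k = T^k ρ₀`, `numSites := 0`, `wilsonBG := 0`,
every representation clause `False`) [decided toy] -/
def toyConstruction : B16.Construction := fun p =>
  { flow := ⟨fun _ => p.g0, fun _ _ => 0⟩
    Cfg := fun k => GaugeField (F.P p.K) k G
    dom := fun _ => ∅
    effAction := fun _ _ => 0
    wilsonBG := fun _ _ => 0
    Ek := fun _ _ => 0
    numSites := fun _ => 0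
    Repr := fun _ => False
    IndAss := fun _ => False
    ρ := fun k => rtIterate F (toyAv F G) p.K p.g0 k
    χ := fun _ _ => 1
    Sect2Form := fun _ => False }

/-- its small-field part is the placeholder's [decided toy] -/
theorem toyConstruction_toB12 :
    (toyConstruction F G).toB12 = (stubConstruction F G (toyAv F G)).toB12 := rfl

variable [RegularGaugeGroup G]

omit [HaarData G] in
/-- the toy's averagings are measurable [decided toy] -/
theorem measurable_toyAv : ∀ K j, Measurable (toyAv F G K j).avg :=
  fun _ _ => BlockAveraging.measurable_avgFun (LoopAverage.trivial G) LoopAverage.measurableE_trivial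

/-- the toy's averagings satisfy `HaarAC` in the standing range (`haarAC_avgFun_trivial`) [decided toy] -/
theorem haarAC_toyAv : ∀ K k, k < K → HaarAC (toyAv F G K k).avg :=
  fun K k hk => haarAC_avgFun_trivial F G K k hk

/-- the realisation of the toy construction by its averagings (the placeholder's, verbatim: `cfg` = identity, `ρ₀` =
the Boltzmann weight with constant `1`, `Tρ_k = ρ_{k+1}` the Radon–Nikodym transport, `R := id`) [decided toy] -/
def toyRealisation : Realisation F G (toyConstruction F G) (toyAv F G) where
  cfg := fun _ _ _ => Equiv.refl _
  rho_zero := fun _ _ => ⟨1, one_pos, fun _ => (one_mul _).symm⟩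
  Trho := fun K g₀ k => rtIterate F (toyAv F G) K g₀ (k + 1)
  isRT_Trho := fun K g₀ k hk =>
    isRT_rnTransport_of_ac _ (measurable_toyAv F G K k) (haarAC_toyAv F G K k hk) _
      (integrable_rtIterate F (toyAv F G) (measurable_toyAv F G) (haarAC_toyAv F G) K g₀ k hk.le)
  R := fun _ _ _ => id
  preservesIntegral_R := fun _ _ _ _ _ => rfl
  rho_succ_eq := fun _ _ _ _ => rfl

/-- **THE TOY DATUM**: finite-`ε` data on the χ := 1 twin of the placeholder construction. [decided toy] -/
def toyData : FiniteEpsData F G where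
  C := toyConstruction F G
  βfun := zeroHBeta
  curries := by rw [show (toyConstruction F G).toB12 = _ from toyConstruction_toB12 F G]; exact curriesHBeta_stub F G _
  fwd := by rw [show (toyConstruction F G).toB12 = _ from toyConstruction_toB12 F G]; exact forwardGenerated_stub F G _
  av := toyAv F G
  real := toyRealisation F G

/-- the toy's characteristic functions are `1` [decided toy] -/
@[simp] theorem toy_χ (p : B12.RunParams) (k : ℕ) (V : ((toyData F G).C p).Cfg k) :
    ((toyData F G).C p).χ k V = 1 := rfl

/-- the toy's Wilson actions of the background are `0` [decided toy] -/
@[simp] theorem toy_wilsonBG (p : B12.RunParams) (k : ℕ) (V : ((toyData F G).C p).Cfg k) :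
    ((toyData F G).C p).wilsonBG k V = 0 := rfl

/-- the toy's coupling flow is constant [decided toy] -/
@[simp] theorem toy_flow_g (p : B12.RunParams) (k : ℕ) : ((toyData F G).C p).flow.g k = p.g0 := rfl

/-- the toy's site counts are `0` [decided toy] -/
@[simp] theorem toy_numSites (p : B12.RunParams) (k : ℕ) : ((toyData F G).C p).numSites k = 0 := rfl

/-- the toy satisfies the sign convention `χ ≥ 0` [decided toy] -/
theorem signConventions_toy : B16.SignConventions (toyData F G).C := fun _ _ _ => zero_le_one

/-- HONESTY CERTIFICATE: (B) FAILS on the toy (its `Sect2Form` is `False`, exactly as for the placeholder) — the apex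
theorem is vacuous AT this datum; the toy tests the witness shape, nothing else. [decided toy] -/
theorem not_endStatementBPrinted_toy : ¬ B16.EndStatementBPrinted (toyData F G).C := by
  rintro ⟨⟨γ, hγ, h⟩, -⟩
  have hint : ((toyData F G).C ⟨0, F.m, γ⟩).flow.InInterval γ 0 := fun k _ => ⟨hγ, le_rfl⟩
  exact h ⟨0, F.m, γ⟩ hint 0 le_rfl

/-- **THE TOY'S SMALL-FIELD WILSON MASS IS `1`**: `∫ 1 · exp(−g_K⁻²·0) dV_K = 1` (product Haar measure is a
probability measure). [decided toy] -/
theorem smallFieldMass_toy (K : ℕ) (g₀ : ℝ) : smallFieldMass (toyData F G) K g₀ = 1 := by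
  simp [smallFieldMass]

/-- **THE PLACEHOLDER'S SMALL-FIELD WILSON MASS IS `0`** (`χ := 0`). [decided toy] -/
theorem smallFieldMass_stubData (av : (K j : ℕ) → Averaging (F.P K) j G) (hmeas : ∀ K j, Measurable (av K j).avg)
    (hac : ∀ K k, k < K → HaarAC (av K k).avg) (K : ℕ) (g₀ : ℝ) :
    smallFieldMass (stubData F G av hmeas hac) K g₀ = 0 := by
  have h : ∀ (k : ℕ) (V : (stubConstruction F G av ⟨K, F.m, g₀⟩).Cfg k),
      (stubConstruction F G av ⟨K, F.m, g₀⟩).χ k V = 0 := fun _ _ => rfl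
  simp [smallFieldMass, h]

/-- the constant bare couplings `g₀ ≡ 1` of the toy run [decided toy] -/
def gOne : ℕ → ℝ := fun _ => 1

/-- the toy run is TUNED within `]0, 1]` to `g = 1` (the apex quantifies its witnesses over tuned runs) [decided toy] -/
theorem tuned_toy : (toyData F G).Tuned 1 1 gOne := fun _ => ⟨fun _ _ => ⟨one_pos, le_rfl⟩, rfl⟩

end Toy

/-! ## §2 The toy's dressed integrals for the empty loop string -/

section Dressed

variable (F : T4Family) (G : Type) [GaugeGroup G] [MeasurableSpace G] [HaarData G] [RegularGaugeGroup G]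

omit [GaugeGroup G] [MeasurableSpace G] [HaarData G] [RegularGaugeGroup G] in
/-- the product observable of the EMPTY string is `1` [folklore] -/
theorem prodObs_nil {O : Type*} (S : TorusScheme G O) (K : ℕ) (U : GaugeField (S.P K) 0 G) :
    T4GenFunBounds.prodObs S K ([] : List O) U = 1 := by
  simp [T4GenFunBounds.prodObs]

/-- **THE TOY'S DRESSED INTEGRAL** of run `K` at source `t` for the empty string, in Bałaban's normalisation:
`Ztoy K t = ∫ e^{t · 1} ρ₀(U) dU` on the `K`-th torus. [decided toy] -/
def Ztoy (K : ℕ) (t : ℝ) : ℝ :=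
  ∫ U, Real.exp (t * T4GenFunBounds.prodObs ((toyData F G).scheme gOne) K ([] : List (ULoop F)) U) *
    (toyData F G).dens K (gOne K) 0 U ∂fieldMeasure (F.P K) 0 G

/-- the source factors out: `Ztoy K t = e^t · Ztoy K 0` [decided toy] -/
theorem Ztoy_eq_exp_mul (K : ℕ) (t : ℝ) : Ztoy F G K t = Real.exp t * Ztoy F G K 0 := by
  simp only [Ztoy, prodObs_nil, mul_one, Real.exp_zero, one_mul]
  exact integral_const_mul _ _

/-- the dressed integrals are positive (`c · dressedZ`, `T4StabilitySocket.exists_const_dressedZ`,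
`T4GenFunBounds.dressedZ_pos`) [decided toy] -/
theorem Ztoy_pos (K : ℕ) (t : ℝ) : 0 < Ztoy F G K t := by
  obtain ⟨c, hc, -, h⟩ := exists_const_dressedZ (toyData F G) K (gOne K)
  unfold Ztoy
  rw [h]
  have hF : T4GenFunBounds.prodObs ((toyData F G).scheme gOne) K ([] : List (ULoop F)) = fun _ => (1 : ℝ) :=
    funext (prodObs_nil G _ K)
  rw [hF]
  exact mul_pos hc
    (T4GenFunBounds.dressedZ_pos (F.P K) (B := 1) (sq_nonneg _) measurable_const (fun _ => abs_one.le) t)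

/-- **THE TOY'S TWO-RUN LOG-RATIO** `nuToy K := log (Ztoy (K+1) 0 ∕ Ztoy K 0)` — source-free. [decided toy] -/
def nuToy (K : ℕ) : ℝ := Real.log (Ztoy F G (K + 1) 0 / Ztoy F G K 0)

/-- **THE PER-TERM SANDWICH IS AN IDENTITY on the toy**: `e^{nuToy K} · Ztoy K t = Ztoy (K+1) t` for EVERY source `t`.
[decided toy] -/
theorem exp_nuToy_mul_Ztoy (K : ℕ) (t : ℝ) : Real.exp (nuToy F G K) * Ztoy F G K t = Ztoy F G (K + 1) t := by
  have h0 := Ztoy_pos F G K 0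
  have h1 := Ztoy_pos F G (K + 1) 0
  rw [nuToy, Real.exp_log (div_pos h1 h0), Ztoy_eq_exp_mul F G K t, Ztoy_eq_exp_mul F G (K + 1) t]
  field_simp

end Dressed

/-! ## §3 The witness term -/

section Witness

variable (F : T4Family) (G : Type) [GaugeGroup G] [MeasurableSpace G] [HaarData G] [RegularGaugeGroup G]

/-- the toy pedigree on NO components [decided toy] -/
def toyPed : Pedigree Empty Unit where
  step := fun c => c.elim
  parts := fun c => c.elim
  step_lt := fun c => c.elim

/-- the toy reading: the empty pedigree at every cutoff and term [decided toy] -/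
def toyPedR : ℕ → Unit → Pedigree Empty Unit := fun _ _ => toyPed

/-- the toy reading: NO live component [decided toy] -/
def toyLive : ℕ → Unit → Finset Empty := fun _ _ => ∅

/-- the toy's term family: ONE term per cutoff [decided toy] -/
def toyT : ℕ → Finset Unit := fun _ => {()}

/-- the member set of a term with no live component is empty [decided toy] -/
theorem memOf_toyLive {γ : Type*} [DecidableEq γ] (cellOf : ℕ → Unit → Empty → γ) (K : ℕ) (τ : Unit) :
    memOf toyPedR toyLive cellOf K τ = ∅ :=
  Finset.image_empty _

/-- … so there is NO bad term [decided toy] -/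
theorem not_mem_badTerms_toy {γ : Type*} [DecidableEq γ] (cellOf : ℕ → Unit → Empty → γ) (jstar : ℕ → ℕ) (T : ℕ → Finset Unit)
    {K : ℕ} {τ : Unit} (h : τ ∈ badTerms (memOf toyPedR toyLive cellOf) jstar T K) : False := by
  obtain ⟨-, q, hq, -⟩ := mem_badTerms.1 h
  rw [memOf_toyLive] at hq
  exact Finset.notMem_empty _ hq

/-- … and NO bad class [decided toy] -/
theorem not_mem_badClasses_toy {γ : Type*} [DecidableEq γ] (cellOf : ℕ → Unit → Empty → γ) (jstar : ℕ → ℕ)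
    (T : ℕ → Finset Unit) {K : ℕ} {c : Finset (BSlot γ PEv)}
    (h : c ∈ badClasses Prod.fst (memOf toyPedR toyLive cellOf) jstar T K) : False := by
  obtain ⟨τ, hτ, -⟩ := mem_badClasses.1 h
  exact not_mem_badTerms_toy cellOf jstar T hτ

/-- **THE WITNESS TERM** (module docstring §3): every field of `CountRoadWitness` on the toy datum, for the empty string
at the tuned constant run `g₀ ≡ 1`, for EVERY `C O rr d n`. [decided toy] -/
def toyWitness (C : T4PrintedShapeBanking.Consts) (O : PrintedO1s) (rr d n : ℕ) :
    CountRoadWitness (toyData F G) C O rr d n gOne ([] : List (ULoop F)) Unit Empty Unit where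
  l₀ := 1
  vol := 1
  l₀_pos := one_pos
  vol_pos := one_pos
  K₀ := 0
  T := toyT
  A := fun K t _ => Ztoy F G K t
  A' := fun K t _ => Ztoy F G (K + 1) t
  shA := fun _ _ _ => 0
  shB := fun _ _ _ => 0
  dead := fun _ _ _ => 0
  dead' := fun _ _ _ => 0
  nup := fun _ _ => 0
  mup := fun _ _ => 0
  Nup := 0
  Cc := fun K _ _ => nuToy F G K
  Rr := fun _ _ _ => 0
  CcRec := fun _ _ _ => 0
  RrRec := fun _ _ _ => 0
  ν := nuToy F G
  u := fun _ => 0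
  s₂ := fun _ => 0
  q₀ := fun _ => 0
  r := fun _ => 0
  s := fun _ => 0
  Wsh := fun _ => 0
  reprA := fun K t _ _ => by rw [toyT, sum_singleton]; rfl
  reprB := fun K t _ _ => by rw [toyT, sum_singleton]; rfl
  c₀ := 1
  n₁ := 0
  c₀_pos := one_pos
  floor := fun K _ => (smallFieldMass_toy F G K (gOne K)).ge
  floor' := fun K _ => (smallFieldMass_toy F G (K + 1) (gOne (K + 1))).ge
  sites := fun K _ => by rw [toy_numSites, Nat.cast_zero]
  sites' := fun K _ => by rw [toy_numSites, Nat.cast_zero]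
  Nup_nonneg := le_rfl
  nup_bd := fun _ _ _ _ => ⟨le_rfl, le_rfl⟩
  mup_bd := fun _ _ _ _ => ⟨le_rfl, le_rfl⟩
  R := fun _ _ => 1
  isRj := fun K s _ => by
    refine ⟨0, (pow_zero _).symm, ?_, fun _ _ => Nat.zero_le _⟩
    show (Real.log ((1 : ℝ) ^ 2)⁻¹) ^ rr ≤ ((1 : ℕ) : ℝ)
    rw [one_pow, inv_one, Real.log_one, Nat.cast_one]
    exact pow_le_one₀ le_rfl zero_le_one
  one_le_R := fun _ _ _ => le_rfl
  ped := toyPedR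
  cellP := fun _ _ _ => (fun _ => 0, ∅)
  liveC := toyLive
  Zd := fun _ _ c => c.elim
  realised :=
    ⟨fun _ _ _ _ c => c.elim, fun _ _ _ _ c => c.elim, fun _ _ _ _ c => c.elim, fun _ _ _ _ c => c.elim,
      fun _ _ _ _ c => c.elim, fun _ _ _ _ c => c.elim, fun _ _ _ _ c => c.elim⟩
  κ := fun _ _ _ _ => 0
  κ' := fun _ _ _ _ => 0
  cost_le := fun _ _ τ hτ => (not_mem_badTerms_toy _ _ _ hτ).elim
  cost_le' := fun _ _ τ hτ => (not_mem_badTerms_toy _ _ _ hτ).elim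
  Fc := fun _ _ => 0
  Rf := fun _ _ => 0
  Fc' := fun _ _ => 0
  Rf' := fun _ _ => 0
  price := fun _ _ _ _ τ hτ => (not_mem_badTerms_toy _ _ _ hτ).elim
  price' := fun _ _ _ _ τ hτ => (not_mem_badTerms_toy _ _ _ hτ).elim
  up := fun _ _ _ _ c hc => (not_mem_badClasses_toy _ _ _ hc).elim
  dead_nonneg := fun _ _ _ _ c hc => (not_mem_badClasses_toy _ _ _ hc).elim
  resum := fun _ _ _ _ c hc => (not_mem_badClasses_toy _ _ _ hc).elim
  F_nonneg := fun _ _ _ _ c hc => (not_mem_badClasses_toy _ _ _ hc).elim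
  up' := fun _ _ _ _ c hc => (not_mem_badClasses_toy _ _ _ hc).elim
  dead'_nonneg := fun _ _ _ _ c hc => (not_mem_badClasses_toy _ _ _ hc).elim
  resum' := fun _ _ _ _ c hc => (not_mem_badClasses_toy _ _ _ hc).elim
  F'_nonneg := fun _ _ _ _ c hc => (not_mem_badClasses_toy _ _ _ hc).elim
  shell :=
    { nonneg := fun _ => le_rfl
      summable := summable_zero
      sh_nonneg_left := fun _ _ _ _ _ => le_rfl
      sh_le_left := fun K t _ _ _ => (Ztoy_pos F G K t).le
      sh_nonneg_right := fun _ _ _ _ _ => le_rfl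
      sh_le_right := fun K t _ _ _ => (Ztoy_pos F G (K + 1) t).le
      left := fun _ _ _ => by simp
      right := fun _ _ _ => by simp }
  budget :=
    { nonneg := fun K t _ _ _ => by simpa only [sub_zero] using (Ztoy_pos F G K t).le
      lower := fun K t _ _ _ => by simpa only [sub_zero] using (exp_nuToy_mul_Ztoy F G K t).le
      upper := fun K t _ _ _ => by simpa only [sub_zero, add_zero] using (exp_nuToy_mul_Ztoy F G K t).ge
      uv_const := fun _ _ _ _ _ => by simp
      uv_radius := fun _ _ _ _ _ => by simp
      recent_remainder := fun _ _ _ _ _ => by simp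
      recent_deviation := fun _ _ _ _ _ => by simp }
  sum_r := summable_zero
  sum_u := summable_zero
  sum_s := summable_zero
  sum_s₂ := summable_zero

/-- **ROW S12h — THE COUNT-ROAD WITNESS SHAPE IS JOINTLY SATISFIABLE**: on the toy datum, for the empty loop string at
the tuned constant run `g₀ ≡ 1`, `CountRoadWitness` is inhabited (for every `C O rr d n`).  A node test of a hypothesis
SHAPE; discharges nothing of the nine spine estimates; NE7b NOT proved. [decided toy] -/
theorem nonempty_countRoadWitness_toy (C : T4PrintedShapeBanking.Consts) (O : PrintedO1s) (rr d n : ℕ) :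
    Nonempty (CountRoadWitness (toyData F G) C O rr d n gOne ([] : List (ULoop F)) Unit Empty Unit) :=
  ⟨toyWitness F G C O rr d n⟩

/-- … in the apex's quantifier pattern: a positive `γ`, a positive `g`, a run tuned to them, and for the (empty)
string the index and payload types with their decidable equalities and an inhabited witness. [decided toy] -/
theorem exists_tuned_countRoadWitness_toy (C : T4PrintedShapeBanking.Consts) (O : PrintedO1s) (rr d n : ℕ) :
    ∃ (γ g : ℝ) (g₀ : ℕ → ℝ), 0 < γ ∧ 0 < g ∧ (toyData F G).Tuned γ g g₀ ∧
      ∃ (ι α π : Type) (_ : DecidableEq ι) (_ : DecidableEq α) (_ : DecidableEq π),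
        Nonempty (CountRoadWitness (toyData F G) C O rr d n g₀ ([] : List (ULoop F)) ι α π) :=
  ⟨1, 1, gOne, one_pos, one_pos, tuned_toy F G, Unit, Empty, Unit, inferInstance, inferInstance, inferInstance,
    nonempty_countRoadWitness_toy F G C O rr d n⟩

end Witness

/-! ## §4 The located obstruction on the placeholder inhabitant: the (γ) floor -/

section Stub

variable (F : T4Family) (G : Type) [GaugeGroup G] [MeasurableSpace G] [HaarData G] [RegularGaugeGroup G]

/-- **ON THE TREE'S OWN INHABITANT THE SHAPE IS EMPTY**: for `T4FiniteEpsInhabited.stubData` (χ := 0) there is NO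
count-road witness, whatever the constants, string, run and index types — the (γ) floor field asks
`0 < c₀ ≤ smallFieldMass = 0`.  This is the census line «satisfiable modulo ⟨floor⟩» made a kernel fact: every other
field of §3's witness transfers verbatim to the placeholder; `floor` alone cannot. [decided toy] -/
theorem isEmpty_countRoadWitness_stubData (av : (K j : ℕ) → Averaging (F.P K) j G)
    (hmeas : ∀ K j, Measurable (av K j).avg) (hac : ∀ K k, k < K → HaarAC (av K k).avg)
    (C : T4PrintedShapeBanking.Consts) (O : PrintedO1s) (rr d n : ℕ) (g₀ : ℕ → ℝ) (os : List (ULoop F))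
    (ι α π : Type) [DecidableEq ι] [DecidableEq α] [DecidableEq π] :
    IsEmpty (CountRoadWitness (stubData F G av hmeas hac) C O rr d n g₀ os ι α π) :=
  ⟨fun X => by
    have h := X.floor X.K₀ le_rfl
    rw [smallFieldMass_stubData] at h
    exact absurd h (not_le.2 X.c₀_pos)⟩

end Stub

end

end Summit.QuantumFields.BalabanUV.T4Continuum.HistoryRealiseCellsRunApexWitness
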